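/-
Origin: expansion seat `planner-pub-hodgecm-pv03-0`, handover v4 2026-08-18T03:54:46Z (`HOME/pub-hodgecm-pv03/lean/Pv03/PerL34/BallGlue.lean`, md5 b0078db7, 144 lines);
landed by the gen-5 packager in gate run 20 as `HodgeCM/PerL34/BallGlue.lean` (import ^import Pv0[0-9]\.PerL34\.→import HodgeCM.PerL34. ×2).
-/
/-
Copyright: pub-hodgecm formalisation cell (harness21, 2026). New file (not vendored).
Origin: HOME/pub-hodgecm-pv03/lean/Pv03/PerL34/BallGlue.lean (WIP module `Pv03.PerL34.BallGlue`; intended final place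
`HodgeCM/PerL34/BallGlue.lean` = module `HodgeCM.PerL34.BallGlue`) (seat planner-pub-hodgecm-pv03-0, DAG node N33,
PerL v5 Prop 4.3, tex ll. 639–682).
-/
import Summits.HodgeConjecture.HodgeCM.PerL34.WedgeFromLineField
import Summits.HodgeConjecture.HodgeCM.PerL34.Ball_2

/-!
# Prop 4.3 over the canonical ball model: three shell inputs discharged

`WedgeFromLineField.lean` reduces the package input `T.Open_thetaWedge` ("the heart", A6) to
`LevelDirected` (PROVED) + `N33eClosed` (= node N33e, PROVED by seat pv01) + `StepsPrintInput T`, where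
`StepsPrintInput` asks, for each good context, for a topological forms model `F : FormsModelT U V` satisfying
`F.StepsPrint = N33c ∧ Print_dense ∧ Print_transitive ∧ Print_cocycle ∧ Print_isotropy ∧ allowed₁ ∧ allowed₂`
and the three dictionary Props.

Here the shell `(G, X, W, A, x₀, e)` of `F` is FIXED to the canonical model of `Ball.lean`
(`U21 = U(2,1)`, `Ball = 𝔹²`, `W = ℂ²`, cotangent cocycle `A`, `x₀ = 0`, `e = id`), for which
`Print_transitive`, `Print_cocycle`, `Print_isotropy` are THEOREMS (`BallModel.transitive`, `BallModel.A_injective`,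
`BallModel.A_continuous`, `BallModel.isotropy_SU2`).  Consequently:

* `n33e_ball` — node N33e for the actual ball: from `N33eClosed`, for every dense subgroup `Δ ≤ U(2,1)` and
  every pair of non-zero, `Δ`-stable spaces `𝒰₁, 𝒰₂` of continuous `W`-valued functions on `𝔹²`, some
  `u₁ ∈ 𝒰₁, u₂ ∈ 𝒰₂` are linearly independent at some point;
* `BallFormsModel` — the remaining DATA of a forms model (`Δ`, index types of allowed data, generators,
  `allowed`, `lvl`, `cls`), `BallFormsModel.toFormsModelT` — its canonical topological forms model;
* `stepsPrint_of_ball : N33c_statement → Dense Δ → (∀ d, allowed₁ d) → (∀ d, allowed₂ d) → StepsPrint`;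
* `BallStepsInput T` and `open_thetaWedge_of_ballSteps : LevelDirected → N33eClosed → BallStepsInput T →
  T.Open_thetaWedge` — the package input A6 from: N33c (INTERNAL, nodes N33a/N33b, seats pv02/pv04/pv14),
  `Dense Δ` (PRINT: real approximation [San] Cor. 3.5(iii) / [PR] Thm. 7.7, PerL ll. 672–677), the allowed data
  (L4.2(b) = node N31), and the three dictionary Props `Dict_thetaClass₀/₁`, `Dict_cupWedge` (DEFINITIONAL + PRINT
  Voisin I Prop. 7.5 / Cor. 7.6 / Cor. 6.15, see `WedgeToClasses.lean`).

No new mathematical input is introduced in this file; it is assembly only.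
-/

noncomputable section

namespace HodgeCM
namespace PerL34
namespace BallGlue

open HodgeCM.PerL34.WedgeNonvanishing HodgeCM.PerL34.WedgeToClasses HodgeCM.PerL34.BallModel

/-- **N33e on the ball.**  The closed line-field statement specialised to the canonical model: only the density
of `Δ` and the hypotheses on `𝒰₁, 𝒰₂` remain. -/
theorem n33e_ball (h : N33eClosed) (Δ : Subgroup U21) (hΔ : Dense (Δ : Set U21))
    (𝒰₁ 𝒰₂ : Submodule ℂ (Ball → (Fin 2 → ℂ))) (h₁ : ∀ u ∈ 𝒰₁, Continuous u) (h₂ : ∀ u ∈ 𝒰₂, Continuous u)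
    (s₁ : StableUnder Δ A 𝒰₁) (s₂ : StableUnder Δ A 𝒰₂) (n₁ : 𝒰₁ ≠ ⊥) (n₂ : 𝒰₂ ≠ ⊥) :
    ∃ u₁ ∈ 𝒰₁, ∃ u₂ ∈ 𝒰₂, ∃ x : Ball, LinearIndependent ℂ ![u₁ x, u₂ x] :=
  h U21 Ball (Fin 2 → ℂ) Δ hΔ transitive A A_injective x₀ (A_continuous x₀) (LinearEquiv.refl ℂ _)
    (fun g hg => by simpa using isotropy_SU2 g hg) 𝒰₁ 𝒰₂ h₁ h₂ s₁ s₂ n₁ n₂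

variable {L : CMField} {ι₁ : L →+* ℂ}

/-- The DATA of a forms model over the canonical ball shell (everything of `FormsModelT` except the shell). -/
structure BallFormsModel (U : Universe) (V : HermSpace3 L ι₁) where
  /-- the image of `G_U(L₀)` in `U(2,1)` -/
  Δ : Subgroup U21
  /-- characters `χ'₁` of `[U(W₁)]` of archimedean type `e(Ψ₁)` -/
  D₁ : Type
  /-- characters `χ'₂` of `[U(W₂)]` of archimedean type `e(Ψ₂)` -/
  D₂ : Type
  /-- `{u_f : f ∈ Θ₁(χ'₁)[𝔭₊]}` -/
  gen₁ : D₁ → Submodule ℂ (Ball → (Fin 2 → ℂ))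
  /-- `{u_f : f ∈ Θ₂(χ'₂)[𝔭₊]}` -/
  gen₂ : D₂ → Submodule ℂ (Ball → (Fin 2 → ℂ))
  /-- "`(W₁, μ₁, χ'₁)` is an allowed datum" -/
  allowed₁ : D₁ → Prop
  /-- "`(W₂, μ₂, χ'₂)` is an allowed datum" -/
  allowed₂ : D₂ → Prop
  /-- a torsion-free level of the form -/
  lvl : (Ball → (Fin 2 → ℂ)) → Level V
  /-- the de Rham class on `P_Γ` of a form descending to `Γ` -/
  cls : (Γ : Level V) → (Ball → (Fin 2 → ℂ)) → U.CohC (U.pms L ι₁ V Γ) 1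

variable {U : Universe} {V : HermSpace3 L ι₁}

namespace BallFormsModel

variable (B : BallFormsModel U V)

/-- The canonical topological forms model of a `BallFormsModel`: shell = (`U(2,1)`, `𝔹²`, `ℂ²`, cotangent
cocycle, `x₀ = 0`, `e = id`). -/
def toFormsModelT : FormsModelT U V where
  G := U21
  X := Ball
  W := Fin 2 → ℂ
  Δ := B.Δ
  A := A
  D₁ := B.D₁
  D₂ := B.D₂
  gen₁ := B.gen₁
  gen₂ := B.gen₂
  allowed₁ := B.allowed₁
  allowed₂ := B.allowed₂
  lvl := B.lvl
  cls := B.cls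
  x₀ := x₀
  e := LinearEquiv.refl ℂ _

/-- (Ported verbatim from the HodgeCMPerL package; no docstring in the source.) -/
theorem print_transitive : B.toFormsModelT.Print_transitive := transitive

/-- (Ported verbatim from the HodgeCMPerL package; no docstring in the source.) -/
theorem print_cocycle : B.toFormsModelT.Print_cocycle := ⟨A_injective, A_continuous x₀⟩

/-- (Ported verbatim from the HodgeCMPerL package; no docstring in the source.) -/
theorem print_isotropy : B.toFormsModelT.Print_isotropy := fun g hg => by
  obtain ⟨k, hk, c, hc, hw⟩ := isotropy_SU2 g hg
  exact ⟨k, hk, c, hc, fun w => hw w⟩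

/-- Over the ball model, `StepsPrint` needs only N33c, the density of `Δ`, and the allowed data. -/
theorem stepsPrint_of_ball (hc : N33c_statement B.Δ A B.gen₁ B.gen₂) (hΔ : Dense (B.Δ : Set U21))
    (ha₁ : ∀ d, B.allowed₁ d) (ha₂ : ∀ d, B.allowed₂ d) : B.toFormsModelT.StepsPrint :=
  ⟨hc, hΔ, B.print_transitive, B.print_cocycle, B.print_isotropy, ha₁, ha₂⟩

end BallFormsModel

variable (T : U.ThetaModel)

/-- The residual input of node N33 over the ball model: per good context, ball forms data with N33c, `Δ` dense,
all data allowed, and the three dictionary Props. -/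
def BallStepsInput : Prop :=
  ∀ {L : CMField} {ι₁ : L →+* ℂ} (V : HermSpace3 L ι₁) (c : SeesawCtx L), T.GoodCtx ι₁ c →
    ∃ B : BallFormsModel U V, N33c_statement B.Δ A B.gen₁ B.gen₂ ∧ Dense (B.Δ : Set U21) ∧
      (∀ d, B.allowed₁ d) ∧ (∀ d, B.allowed₂ d) ∧ B.toFormsModelT.Dict_thetaClass₀ T c ∧
      B.toFormsModelT.Dict_thetaClass₁ T c ∧ B.toFormsModelT.toFormsModel.Dict_cupWedge

/-- (Ported verbatim from the HodgeCMPerL package; no docstring in the source.) -/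
theorem stepsPrintInput_of_ball (h : BallStepsInput T) : StepsPrintInput T := by
  intro L ι₁ V c hc
  obtain ⟨B, hN33c, hΔ, ha₁, ha₂, h₀, h₁, hcup⟩ := h V c hc
  exact ⟨B.toFormsModelT, B.stepsPrint_of_ball hN33c hΔ ha₁ ha₂, h₀, h₁, hcup⟩

/-- **A6 over the ball model.**  `Open_thetaWedge` from `LevelDirected` (PROVED, `HodgeCM.levelDirected`),
`N33eClosed` (node N33e, PROVED by seat pv01) and `BallStepsInput T`. -/
theorem open_thetaWedge_of_ballSteps (hLD : LevelDirected) (hE : N33eClosed) (h : BallStepsInput T) :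
    T.Open_thetaWedge :=
  open_thetaWedge_of_printSteps T hLD hE (stepsPrintInput_of_ball T h)

end BallGlue
end PerL34
end HodgeCM

end
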